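import Summits.BirchSwinnertonDyer.BirchSwinnertonDyer.Theorems.CyclotomicUntwistSigmaLineFamilyPrimeDilation
import Summits.BirchSwinnertonDyer.BirchSwinnertonDyer.Theorems.CyclotomicUntwistSigmaLineFamilyHeightDatumUnique
import Literature.NumberTheory.EllipticCurves.CanonicalPAdicHeightLeavesProofs
import Literature.NumberTheory.EllipticCurves.PadicPointsFiltration
import HarnessLib

/-!
# Route `CyclotomicUntwist`, crux K1 `PSRankOneLowerHalfAtThree` (stmt-BirchSwinnertonDyer-21580):
# the σ-LINE FAMILY — the PARALLELOGRAM LAW and the σ_c-HEIGHT DATUM ONE LEVEL HIGHER (`v(z) ≥ 2`, `p ≥ 3`)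

Cell `pub/bsd-wall` (D-0145 line `route-BirchSwinnertonDyer-CyclotomicUntwist`), seat `bsd-line-cycu-p1`
g4, lane «σ-LINE FAMILY LAW», file 24. THEOREMS ONLY; helper `--supports` K1 = stmt-BirchSwinnertonDyer-21580.
BSD is not proved by this file and no crux is.

WHAT. `…Parallelogram` / `…HeightDatum` read the parallelogram law and the bilinear datum of the
σ_c-heights on the locus `‖z(P)‖ ≤ p⁻³` (crude radius, `p²`-dilation). With the `p`-dilation
(`…PrimeDilation`, Bernardi's sharp radius) everything moves one level up, to `E⁽²⁾ ∩ ⋂_ℓ E⁰(ℚ_ℓ)`: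
* `two_deep_of_mem_filtration` — `‖x‖ > 1 ∧ ‖z‖ ≤ p⁻² ⇒ ‖x‖ > p²`;
* `padicEval_formalSigma_param_ne_zero_admissible` — `σ_c(z(P)) ≠ 0` at every admissible `P` (`p ≥ 3`);
* **`sigmaHeight_formalSigma_parallelogram_levelTwo`** — `h(P+Q) + h(P−Q) = 2h(P) + 2h(Q)` for `P, Q, P ± Q`
  with `‖xᵢ‖_p > p²`, `x₁ ≠ x₂`, `Q` non-singular mod every prime;
* **`exists_heightDatum_formalSigma_levelTwo`** — `∃ D : PAdicHeightData W p` with `D(P,P) = h_{σ_c}(P)` on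
  `‖x‖_p > 1 ∧ ‖z‖_p ≤ p⁻² ∧` (non-singular mod every `ℓ`); **`heightDatum_levelTwo_eq`** — it is THE σ_c-datum
  of `…HeightDatumUnique` (agreement on the deeper locus + uniqueness there).

References: Mazur–Stein–Tate 2006 §2.6–2.7; Bernardi 1981 §1; Silverman AEC VII.2.2. [cite: MazurSteinTate2006, §2.7]
[cite: SteinWuthrich2013, §4.1 eq. (4.1)] [cite: SilvermanAEC2009, VII.2.2]
-/

set_option autoImplicit false
-- single-conjunct summit: `Summit.BirchSwinnertonDyer.BirchSwinnertonDyer.…` repeats the name by design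
set_option linter.dupNamespace false

noncomputable section

open scoped Classical

open PowerSeries WeierstrassCurve Literature.NumberTheory.EllipticCurves
  Summit.BirchSwinnertonDyer.Rank1Residual.Additive
  Summit.BirchSwinnertonDyer.BirchSwinnertonDyer.Theorems.PSSigmaLineFamilyParallelogram
  Summit.BirchSwinnertonDyer.BirchSwinnertonDyer.Theorems.PSSigmaLineFamilyPrimeDilation
  Summit.BirchSwinnertonDyer.BirchSwinnertonDyer.Theorems.PSSigmaLineFamilyAdmissible
  Summit.BirchSwinnertonDyer.BirchSwinnertonDyer.Theorems.PSSigmaLineFamilyHeightDatumUnique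

namespace Summit.BirchSwinnertonDyer.BirchSwinnertonDyer.Theorems.PSSigmaLineFamilyLevelTwoDatum

variable {p : ℕ} [Fact p.Prime] (W : WeierstrassCurve ℚ) [W.IsElliptic] [W.IsGloballyMinimal]

omit [W.IsElliptic] in
/-- From `‖x‖ > 1` and `‖z‖ ≤ p⁻²`: `‖x‖ > p²` (`‖z‖² = ‖x‖⁻¹`). [Silverman AEC VII.2.2] [folklore] -/
theorem two_deep_of_mem_filtration {x y : ℚ_[p]} (heq : (W.baseChange ℚ_[p]).toAffine.Equation x y)
    (hx : 1 < ‖x‖) (hz : ‖-x / y‖ ≤ ((p : ℝ)⁻¹) ^ 2) : (p : ℝ) ^ 2 < ‖x‖ := by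
  have hp : (1 : ℝ) < p := by exact_mod_cast (Fact.out : p.Prime).one_lt
  have hsq := (W.baseChange ℚ_[p]).norm_formalParameter_sq heq hx
  have hx0 : 0 < ‖x‖ := one_pos.trans hx
  have hz2 : ‖-x / y‖ ^ 2 ≤ (((p : ℝ)⁻¹) ^ 2) ^ 2 := pow_le_pow_left₀ (norm_nonneg _) hz 2
  rw [hsq, ← pow_mul, inv_pow] at hz2
  have hx4 : (p : ℝ) ^ (2 * 2) ≤ ‖x‖ := by
    have := inv_anti₀ (inv_pos.mpr hx0) hz2
    rwa [inv_inv, inv_inv] at this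
  calc (p : ℝ) ^ 2 < (p : ℝ) ^ (2 * 2) := pow_lt_pow_right₀ hp (by norm_num)
    _ ≤ ‖x‖ := hx4

omit [W.IsElliptic] in
/-- `σ_c(z(P)) ≠ 0` at every admissible point (`p ≥ 3`, `‖c‖ ≤ 1`). [Bernardi 1981, §1] [cite: MazurTate1991, Thm. 3.1] -/
theorem padicEval_formalSigma_param_ne_zero_admissible (hp : 3 ≤ p) {c : ℚ_[p]} (hc : ‖c‖ ≤ 1)
    {x y : ℚ_[p]} (heq : (W.baseChange ℚ_[p]).toAffine.Equation x y) (hx : 1 < ‖x‖) :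
    padicEval ((W.baseChange ℚ_[p]).formalSigma c) (-x / y) ≠ 0 :=
  (sigma_admissible (W.baseChange ℚ_[p]) hp hc heq hx).2.2

/-- **PARALLELOGRAM LAW OF THE σ_c-HEIGHTS ONE LEVEL HIGHER (`p ≥ 3`)**: for `W/ℚ` globally minimal,
`c ∈ ℤ_p`, rational points `P, Q` with `P ± Q` affine, `x₁ ≠ x₂`, all four with `‖xᵢ‖_p > p²`, and `Q` with
non-singular reduction at every prime: `h(P+Q) + h(P−Q) = 2h(P) + 2h(Q)` for `h = sigmaHeight W p σ_c`.
[Mazur–Stein–Tate 2006, §2.6–2.7; Bernardi 1981, §1] [cite: MazurSteinTate2006, §2.7] [cite: SteinWuthrich2013, §4.1 eq. (4.1)] -/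
theorem sigmaHeight_formalSigma_parallelogram_levelTwo (hp : 3 ≤ p) {c : ℚ_[p]} (hc : ‖c‖ ≤ 1)
    {x₁ y₁ x₂ y₂ x₃ y₃ x₄ y₄ : ℚ} (h₁ : W.toAffine.Nonsingular x₁ y₁) (h₂ : W.toAffine.Nonsingular x₂ y₂)
    (h₃ : W.toAffine.Nonsingular x₃ y₃) (h₄ : W.toAffine.Nonsingular x₄ y₄) (hx : x₁ ≠ x₂)
    (hS : (.some x₁ y₁ h₁ : W.toAffine.Point) + .some x₂ y₂ h₂ = .some x₃ y₃ h₃)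
    (hD : (.some x₁ y₁ h₁ : W.toAffine.Point) - .some x₂ y₂ h₂ = .some x₄ y₄ h₄)
    (hx₁ : (p : ℝ) ^ 2 < ‖(x₁ : ℚ_[p])‖) (hx₂ : (p : ℝ) ^ 2 < ‖(x₂ : ℚ_[p])‖)
    (hx₃ : (p : ℝ) ^ 2 < ‖(x₃ : ℚ_[p])‖) (hx₄ : (p : ℝ) ^ 2 < ‖(x₄ : ℚ_[p])‖)
    (hns : ∀ ℓ : ℕ, ℓ.Prime → W.HasNonsingularReductionAt ℓ x₂ y₂) :
    CensusX42.sigmaHeight W p ((W.baseChange ℚ_[p]).formalSigma c) (.some x₃ y₃ h₃) +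
        CensusX42.sigmaHeight W p ((W.baseChange ℚ_[p]).formalSigma c) (.some x₄ y₄ h₄) =
      2 * CensusX42.sigmaHeight W p ((W.baseChange ℚ_[p]).formalSigma c) (.some x₁ y₁ h₁) +
        2 * CensusX42.sigmaHeight W p ((W.baseChange ℚ_[p]).formalSigma c) (.some x₂ y₂ h₂) := by
  set V := W.baseChange ℚ_[p] with hVdef
  haveI : V.IsElliptic := by rw [hVdef]; infer_instance
  haveI : V.IsIntegral ℤ_[p] := by rw [hVdef]; infer_instance
  have hmul : padicLog_mul p := padicLog_mul_holds p
  have hpge : (1 : ℝ) ≤ (p : ℝ) ^ 2 := one_le_pow₀ (by exact_mod_cast (Fact.out : p.Prime).one_le)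
  have hθ := theta_at_points_formalSigma_prime V hp hc (nonsingular_ratCast (p := p) h₁)
    (nonsingular_ratCast (p := p) h₂) hx₁ hx₂
  have hS' : (.some (x₁ : ℚ_[p]) (y₁ : ℚ_[p]) (nonsingular_ratCast h₁) : V.toAffine.Point) +
      .some (x₂ : ℚ_[p]) (y₂ : ℚ_[p]) (nonsingular_ratCast h₂) =
        .some (x₃ : ℚ_[p]) (y₃ : ℚ_[p]) (nonsingular_ratCast h₃) := by
    rw [← toPadicPoint_some (p := p) h₁, ← toPadicPoint_some (p := p) h₂, ← map_add, hS, toPadicPoint_some]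
  have hD' : (.some (x₁ : ℚ_[p]) (y₁ : ℚ_[p]) (nonsingular_ratCast h₁) : V.toAffine.Point) -
      .some (x₂ : ℚ_[p]) (y₂ : ℚ_[p]) (nonsingular_ratCast h₂) =
        .some (x₄ : ℚ_[p]) (y₄ : ℚ_[p]) (nonsingular_ratCast h₄) := by
    rw [← toPadicPoint_some (p := p) h₁, ← toPadicPoint_some (p := p) h₂, ← map_sub, hD, toPadicPoint_some]
  rw [hS', hD'] at hθ
  change padicEval (V.formalSigma c) (-(x₃ : ℚ_[p]) / (y₃ : ℚ_[p])) *
      padicEval (V.formalSigma c) (-(x₄ : ℚ_[p]) / (y₄ : ℚ_[p])) = _ at hθ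
  have hden := den_mul_den_eq_of_hasNonsingularReductionAt_right W h₁ h₂ h₃ h₄ hx hS hD hns
  have hdenp : ((x₃.den : ℚ) : ℚ_[p]) * ((x₄.den : ℚ) : ℚ_[p]) =
      ((x₁.den : ℚ) : ℚ_[p]) ^ 2 * ((x₂.den : ℚ) : ℚ_[p]) ^ 2 * ((x₁ : ℚ_[p]) - x₂) ^ 2 := by
    have := congrArg (fun q : ℚ => (q : ℚ_[p])) hden
    push_cast at this ⊢
    exact this
  have hσ₁ := padicEval_formalSigma_param_ne_zero_admissible W hp hc (nonsingular_ratCast (p := p) h₁).1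
    (lt_of_le_of_lt hpge hx₁)
  have hσ₂ := padicEval_formalSigma_param_ne_zero_admissible W hp hc (nonsingular_ratCast (p := p) h₂).1
    (lt_of_le_of_lt hpge hx₂)
  have hσ₃ := padicEval_formalSigma_param_ne_zero_admissible W hp hc (nonsingular_ratCast (p := p) h₃).1
    (lt_of_le_of_lt hpge hx₃)
  have hσ₄ := padicEval_formalSigma_param_ne_zero_admissible W hp hc (nonsingular_ratCast (p := p) h₄).1
    (lt_of_le_of_lt hpge hx₄)
  have hd : ∀ x : ℚ, ((x.den : ℚ) : ℚ_[p]) ≠ 0 := fun x => by exact_mod_cast x.den_nz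
  have hδ : (x₁ : ℚ_[p]) - x₂ ≠ 0 := sub_ne_zero.mpr (by exact_mod_cast hx)
  have hlogd : padicLog p ((x₃.den : ℚ) : ℚ_[p]) + padicLog p ((x₄.den : ℚ) : ℚ_[p]) =
      2 * padicLog p ((x₁.den : ℚ) : ℚ_[p]) + 2 * padicLog p ((x₂.den : ℚ) : ℚ_[p]) +
        2 * padicLog p ((x₁ : ℚ_[p]) - x₂) := by
    rw [← hmul (hd x₃) (hd x₄), hdenp, hmul (mul_ne_zero (pow_ne_zero 2 (hd x₁))
      (pow_ne_zero 2 (hd x₂))) (pow_ne_zero 2 hδ), hmul (pow_ne_zero 2 (hd x₁))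
      (pow_ne_zero 2 (hd x₂)), padicLog_sq (hd x₁), padicLog_sq (hd x₂), padicLog_sq hδ]
  have hlogσ : padicLog p (padicEval (V.formalSigma c) (-(x₃ : ℚ_[p]) / (y₃ : ℚ_[p]))) +
      padicLog p (padicEval (V.formalSigma c) (-(x₄ : ℚ_[p]) / (y₄ : ℚ_[p]))) =
        padicLog p ((x₁ : ℚ_[p]) - x₂) + 2 * padicLog p (padicEval (V.formalSigma c) (-(x₁ : ℚ_[p]) / (y₁ : ℚ_[p]))) +
          2 * padicLog p (padicEval (V.formalSigma c) (-(x₂ : ℚ_[p]) / (y₂ : ℚ_[p]))) := by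
    have hδ' : (x₂ : ℚ_[p]) - x₁ ≠ 0 := by rw [← neg_sub]; exact neg_ne_zero.mpr hδ
    rw [← hmul hσ₃ hσ₄, hθ, hmul (mul_ne_zero hδ' (pow_ne_zero 2 hσ₁)) (pow_ne_zero 2 hσ₂),
      hmul hδ' (pow_ne_zero 2 hσ₁), padicLog_sq hσ₁, padicLog_sq hσ₂, ← neg_sub, padicLog_neg hδ]
  simp only [PSSigmaLineFamilyValues.sigmaHeight_some]
  linear_combination hlogd - 2 * hlogσ

/-- **THE σ_c-HEIGHT DATUM ONE LEVEL HIGHER (`p ≥ 3`)**: `∃ D : PAdicHeightData W p` with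
`D(P,P) = h_{σ_c}(P)` for every `P = (x,y)` with `‖x‖_p > 1`, `‖z(P)‖_p ≤ p⁻²` and non-singular reduction
at every prime (the subgroup `E⁽²⁾ ∩ ⋂_ℓ E⁰(ℚ_ℓ)`). [Mazur–Stein–Tate 2006, §2.6–2.7; Schneider 1982, §1]
[cite: MazurSteinTate2006, §2.7] [cite: Schneider1982PadicHeightI, §1] -/
theorem exists_heightDatum_formalSigma_levelTwo (hp3 : 3 ≤ p) {c : ℚ_[p]} (hc : ‖c‖ ≤ 1) :
    ∃ D : PAdicHeightData W p, ∀ {x y : ℚ} (h : W.toAffine.Nonsingular x y),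
      1 < ‖(x : ℚ_[p])‖ → ‖(-(x : ℚ_[p]) / (y : ℚ_[p]))‖ ≤ ((p : ℝ)⁻¹) ^ 2 →
        (∀ ℓ : ℕ, ℓ.Prime → W.HasNonsingularReductionAt ℓ x y) →
          D.pairing (.some x y h) (.some x y h) =
            CensusX42.sigmaHeight W p ((W.baseChange ℚ_[p]).formalSigma c) (.some x y h) := by
  set H : AddSubgroup W.toAffine.Point :=
    ((W.baseChange ℚ_[p]).formalFiltration 2).comap (W.toPadicPoint p) ⊓
      ⨅ ℓ : Nat.Primes, (haveI : Fact ℓ.1.Prime := ⟨ℓ.2⟩; W.nonsingularReductionSubgroupAt ℓ.1) with hHdef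
  have hmem_some : ∀ {x y : ℚ} (h : W.toAffine.Nonsingular x y),
      (.some x y h : W.toAffine.Point) ∈ H ↔
        (1 < ‖(x : ℚ_[p])‖ ∧ ‖(-(x : ℚ_[p]) / (y : ℚ_[p]))‖ ≤ ((p : ℝ)⁻¹) ^ 2) ∧
          ∀ ℓ : ℕ, ℓ.Prime → W.HasNonsingularReductionAt ℓ x y := by
    intro x y h
    rw [hHdef, AddSubgroup.mem_inf, AddSubgroup.mem_comap, AddSubgroup.mem_iInf, mem_formalFiltration_iff]
    have hι : W.toPadicPoint p (.some x y h) = .some (x : ℚ_[p]) (y : ℚ_[p]) (nonsingular_ratCast h) :=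
      toPadicPoint_some h
    rw [hι]
    constructor
    · rintro ⟨⟨hx, hz⟩, hns⟩
      refine ⟨⟨hx, hz⟩, fun ℓ hℓ => ?_⟩
      haveI : Fact ℓ.Prime := ⟨hℓ⟩
      exact (mem_nonsingularReductionSubgroupAt_iff _).mp (hns ⟨ℓ, hℓ⟩)
    · rintro ⟨⟨hx, hz⟩, hns⟩
      exact ⟨⟨hx, hz⟩, fun ℓ => by
        haveI : Fact ℓ.1.Prime := ⟨ℓ.2⟩
        exact (mem_nonsingularReductionSubgroupAt_iff _).mpr (hns ℓ.1 ℓ.2)⟩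
  have htf : ∀ P ∈ H, IsOfFinAddOrder P → P = 0 := by
    intro P hP hfin
    rcases P with _ | ⟨x, y, h⟩
    · rfl
    · exact (not_isOfFinAddOrder_of_one_lt_padicNorm_holds W p hp3 h ((hmem_some h).mp hP).1.1 hfin).elim
  set q : W.toAffine.Point → ℚ_[p] := CensusX42.sigmaHeight W p ((W.baseChange ℚ_[p]).formalSigma c) with hq
  have hgen : ∀ P ∈ H, ∀ Q ∈ H, P ≠ 0 → Q ≠ 0 → P - Q ≠ 0 → P + Q ≠ 0 →
      q (P + Q) + q (P - Q) = 2 * q P + 2 * q Q := by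
    intro P hP Q hQ hP0 hQ0 hsub hadd
    have hS' : P + Q ∈ H := H.add_mem hP hQ
    have hD' : P - Q ∈ H := H.sub_mem hP hQ
    rcases P with _ | ⟨x₁, y₁, h₁⟩
    · exact (hP0 rfl).elim
    rcases Q with _ | ⟨x₂, y₂, h₂⟩
    · exact (hQ0 rfl).elim
    have hx : x₁ ≠ x₂ := X_ne_of_sub_ne_zero_of_add_ne_zero h₁ h₂ hsub hadd
    rcases hS : (.some x₁ y₁ h₁ : W.toAffine.Point) + .some x₂ y₂ h₂ with _ | ⟨x₃, y₃, h₃⟩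
    · exact (hadd hS).elim
    rcases hD : (.some x₁ y₁ h₁ : W.toAffine.Point) - .some x₂ y₂ h₂ with _ | ⟨x₄, y₄, h₄⟩
    · exact (hsub hD).elim
    rw [hS] at hS'
    rw [hD] at hD'
    obtain ⟨⟨hx₁, hz₁⟩, -⟩ := (hmem_some h₁).mp hP
    obtain ⟨⟨hx₂, hz₂⟩, hns₂⟩ := (hmem_some h₂).mp hQ
    obtain ⟨⟨hx₃, hz₃⟩, -⟩ := (hmem_some h₃).mp hS'
    obtain ⟨⟨hx₄, hz₄⟩, -⟩ := (hmem_some h₄).mp hD'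
    have d₁ := two_deep_of_mem_filtration W (nonsingular_ratCast (p := p) h₁).1 hx₁ hz₁
    have d₂ := two_deep_of_mem_filtration W (nonsingular_ratCast (p := p) h₂).1 hx₂ hz₂
    have d₃ := two_deep_of_mem_filtration W (nonsingular_ratCast (p := p) h₃).1 hx₃ hz₃
    have d₄ := two_deep_of_mem_filtration W (nonsingular_ratCast (p := p) h₄).1 hx₄ hz₄
    rw [hq, hS, hD]
    exact sigmaHeight_formalSigma_parallelogram_levelTwo W hp3 hc h₁ h₂ h₃ h₄ hx hS hD d₁ d₂ d₃ d₄ hns₂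
  have hfull := Literature.NumberTheory.EllipticCurves.parallelogram_of_generic H htf q rfl hgen
  obtain ⟨B, hsymm, htors, hdiag⟩ := Literature.NumberTheory.EllipticCurves.exists_pairing_of_parallelogram H q hfull
  refine ⟨⟨B, hsymm, fun P Q hP => htors P Q hP⟩, ?_⟩
  intro x y h hx hz hns
  exact hdiag _ ((hmem_some h).mpr ⟨⟨hx, hz⟩, hns⟩)

/-- **It is THE σ_c-datum**: any datum reading `h_{σ_c}` on the level-two locus reads it on the deeper
locus of `…HeightDatum`, hence (`heightDatum_ext_of_deep`) two data agreeing with `h_{σ_c}` on the level-two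
locus are EQUAL (and equal to the datum of `exists_heightDatum_formalSigma`). [cite: MazurSteinTate2006, §2.7] -/
theorem heightDatum_levelTwo_eq {c : ℚ_[p]} {D₁ D₂ : PAdicHeightData W p}
    (hD₁ : ∀ {x y : ℚ} (h : W.toAffine.Nonsingular x y),
      1 < ‖(x : ℚ_[p])‖ → ‖(-(x : ℚ_[p]) / (y : ℚ_[p]))‖ ≤ ((p : ℝ)⁻¹) ^ 2 →
        (∀ ℓ : ℕ, ℓ.Prime → W.HasNonsingularReductionAt ℓ x y) →
          D₁.pairing (.some x y h) (.some x y h) =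
            CensusX42.sigmaHeight W p ((W.baseChange ℚ_[p]).formalSigma c) (.some x y h))
    (hD₂ : ∀ {x y : ℚ} (h : W.toAffine.Nonsingular x y),
      1 < ‖(x : ℚ_[p])‖ → ‖(-(x : ℚ_[p]) / (y : ℚ_[p]))‖ ≤ ((p : ℝ)⁻¹) ^ 2 →
        (∀ ℓ : ℕ, ℓ.Prime → W.HasNonsingularReductionAt ℓ x y) →
          D₂.pairing (.some x y h) (.some x y h) =
            CensusX42.sigmaHeight W p ((W.baseChange ℚ_[p]).formalSigma c) (.some x y h)) :
    D₁ = D₂ := by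
  have hp1 : (p : ℝ)⁻¹ ≤ 1 := inv_le_one_of_one_le₀ (by exact_mod_cast (Fact.out : p.Prime).one_le)
  have h32 : ((p : ℝ)⁻¹) ^ 3 ≤ ((p : ℝ)⁻¹) ^ 2 := pow_le_pow_of_le_one (by positivity) hp1 (by norm_num)
  refine heightDatum_ext_of_deep W (p := p) fun h hx hz hns => ?_
  rw [hD₁ h hx (hz.trans h32) hns, hD₂ h hx (hz.trans h32) hns]

end Summit.BirchSwinnertonDyer.BirchSwinnertonDyer.Theorems.PSSigmaLineFamilyLevelTwoDatum

end
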